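import Literature.MathematicalPhysics.QuantumFieldTheory.Balaban1983to89.T4MatchingClosureRecords

/-!
# T4MatchingClosureSocket — node U5, seam (ζ′): the closure chain on the GENERAL NE7c SOCKET `ShellWeightBound`

HONEST FRAMING.  This module is KERNEL BOOKKEEPING ONLY (origin shifts of per-`K` hypotheses, the tail arithmetic "two
summable sequences are eventually `< 1` in sum", and re-assembly BY NAME of the landed modular producers; 0 estimates).
It proves nothing of [Balaban 1983–89]: every analytic input — NE7b (`T4WeightBudget.RelWeightBound`, resp. the two
runs' persistence record models), NE7c (`T4IndicatorShell.ShellWeightBound`), the good-class budget on the cores, the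
remnant feed, the four summable producer rates — is a BINDER, instantiated for nothing.  NOT summit progress; NOT the
continuum limit; NOT Clay.

WHY THIS LEAF (interface exchange GAPS C-pv02g14-4 / C-pv02g14-5; node-U5b owner ruling folded as C-pv02g15-1).  The
landed closure chain `T4MatchingClosure.hybridNE7_closure_tail` → `T4MatchingClosureRem.hybridNE7_closure_remnantW` →
`T4MatchingClosureFed.hybridNE7_closure_fed_steps` → `T4MatchingClosureYoung.hybridNE7_closure_fed_steps_youngWindow` →
`T4MatchingClosureHosts.hybridNE7_closure_hosts` → `T4MatchingClosureRecords.hybridNE7_closure_records` carries the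
NE7c side in ONE presentation only: the FLATTENED nested shells (row T4-U5.E-c-SHELL°), eight binders
`{Acore Bcore L} hL0 hLs hA0 hAlo hAhi hB0 hBlo hBhi`, plugged by `T4NestedShells.shellWeightBound_of_flattened`.  The
node-U5b owner's ruling (design row T4-U5b.E2, seam (ζ)) fixes the closure's NE7c SOCKET as the design-agnostic OUTPUT
SHAPE itself:
* (S1) `hSh : ShellWeightBound l₀ T A B shA shB Wsh` — exactly the shell binder of `T4MatchingClosure.hybridNE7_closure'`
  — with the good-class budget typed on the HYBRID CORES `fun K t τ => A K t τ - shA K t τ`,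
  `fun K t τ => B K t τ - shB K t τ`;
* (S2) `Summable Wsh` is INSIDE the socket (`ShellWeightBound.summable`), supplied by every producer —
  `T4ShellMeasure.shellWeightBound_of_realized` / `T4ShellMeasure.shellWeightBound_of_liveFactor` (design (i)),
  `T4NestedShells.shellWeightBound_of_flattened` (the flattened presentation), `T4LipschitzLedger.shellWeightBound_of_repr`
  → `T4LipschitzCutoff.shellWeightBound_of_lipProfile` (design (η)), `T4MatchingAssembly.shellWeightBound_of_fibres` /
  `T4MatchingAssembly.shellWeightBound_zero` — and is NOT re-asked here;
* (S3) NO `lt_one` / margin field: the weight condition `W K + Wsh K < 1` of `T4MatchingAssembly.HybridNE7` holds on a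
  TAIL `K ≥ K₀` because BOTH `RelWeightBound.summable` and `ShellWeightBound.summable` are fields
  (`T4MatchingClosure.eventually_budget_lt_one`), and every per-`K` hypothesis is stable under the origin shift
  `K ↦ K₀ + K` (an every-`K` margin with uniform constants, `T4ShellSuppressionRoute` §7, is an OPTIONAL consumer-side
  add-on, not a socket field);
* (S4) `A B shA shB` are the two runs' term families AS WRITTEN by the producer under its own convention (which run
  carries a lowered threshold is the producer's business); the other binder blocks quantify over the same `A B`.

WHAT THIS LEAF DOES.  §0: the origin shift for the two weight structures (`shellWeightBound_shift`,
`relWeightBound_shift`; siblings of the landed `T4MatchingClosure.slotDom_shift`, `T4MatchingClosure.reindexedBudget_shift`)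
and THE GENERAL TAIL CLOSURE `hybridNE7_closure'_tail` = `T4MatchingClosure.hybridNE7_closure'` MINUS its binder `hlt`
(ANY `RelWeightBound … W`, ANY `ShellWeightBound … shA shB Wsh`, a `ReindexedBudget` on the cores, four summable rates ⇒
`∃ K₀, HybridNE7` for the `K₀`-shifted families), with its per-string form `stringHybridNE7_closure'_tail`.  §1: the
SOCKET TWINS of the landed chain's lower levels, each ONE application of the landed producers by name —
`hybridNE7_closure_socket` (log-cut weight half; = `hybridNE7_closure_tail` on the socket),
`hybridNE7_closure_socket_remnantW` (NE7b-rem rates: `T4MatchingClosureRem.summable_add_remnantYoungW` /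
`summable_add_remnantOld`), `hybridNE7_closure_socket_fed_steps` (split budget on the cores + per-step feed:
`T4MatchingClosureFed.reindexedBudget_of_steps`, `remnantAgeBound_fed`).  §2: `hybridNE7_closure_socket_hosts` (Lemma Y's
window `T4MatchingClosureYoung.sublinearWindow_youngWindow_of_hq` + the binder `hsteps` discharged by
`T4YoungHosting.steps_feed_of_twoRun_bankYoung (inc K)`, verbatim as in `T4MatchingClosureHosts`).  §3:
`hybridNE7_closure_socket_records` / `stringHybridNE7_closure_socket_records` (`hDA`, `hDB` discharged by
`T4PersistentHistoryCount.slotDom_of_records`, verbatim as in `T4MatchingClosureRecords`).  BINDER LISTS of §1–§3: those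
of the landed flattened theorems with `{Acore Bcore L} hL0 hLs hA0 hAlo hAhi hB0 hBlo hBhi` REPLACED by
`{shA shB Wsh} hSh`, the budget binder (`hTB` / `hSB`) typed on the hybrid cores, and the conclusion's shell slot
`(fun K => shA (K₀ + K)) (fun K => shB (K₀ + K)) (fun K => Wsh (K₀ + K))`; everything else EQUAL, in the landed order.
§4: the flattened chain RECOVERED as the instance `hSh := T4NestedShells.shellWeightBound_of_flattened …` (budget
transport `reindexedBudget_of_cores` / `remnantSplitBudget_of_cores` along `X − (X − Xcore) = Xcore`; one `example`
re-deriving the conclusion of `T4MatchingClosure.hybridNE7_closure_tail` letter for letter from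
`hybridNE7_closure_socket`), and non-vacuity of the general tail closure on the trivial datum.

TYPING DECISIONS.  (Z1) ONE leaf, no version bump: the six landed flattened modules stay as they are (the flattened /
design-(i) SPECIALISATION, §4); nothing is retired or restated.  (Z2) The shifted shell slot is presented η-short as
`fun K => shA (K₀ + K)`, the weight slot as the β-reduced budget `1 − e^{−S(K₀ + K)}` exactly as in the landed chain.
(Z3) The general tail closure asks NO sign / budget / summability hypothesis beyond the two structures' own fields:
`W → 0` and `Wsh → 0` are free from `RelWeightBound.summable`, `ShellWeightBound.summable`.  (Z4) Per-string forms are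
packaged by the landed `T4MatchingClosure.stringHybridNE7_of_shift` (E1/E2 dictionary from `K₀` steps on); the
intermediate levels of §1–§2 get theirs the same way (not spelled out).

NOT DONE HERE.  No producer of `ShellWeightBound` is invoked in §0–§3 (the socket is a binder); no constant of
Bałaban's is chosen; the head `K < K₀` is the scheme's own (`T4MatchingAssembly` §4); the `0 < vol` and
scheme-regularity binders of the node-U0 consumers (`T4MatchingClosureHosts.hasContinuumLimit_of_stringClosures`) are
untouched.

ABSOLUTE RULE.  Every estimate is a BINDER; no internally-minted statement is a cited fact; nothing of
[Balaban 1983–89] is quoted as authority or instantiated; all docstrings [folklore].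
-/

open Finset

namespace Literature.MathematicalPhysics.QuantumFieldTheory.Balaban1983to89.T4MatchingClosureSocket

open Literature.MathematicalPhysics.QuantumFieldTheory.Balaban1983to89
open Literature.Probability.LatticeModels
open T4CauchySum T4WeightBudget T4IndicatorShell T4GoodClassBudget T4HistoryPeeling T4MatchingAssembly T4MatchingClosure
  T4RemnantBooking T4MatchingClosureRem T4MatchingClosureFed T4BankAgeYoung T4MatchingClosureYoung
open B13FamilySum B16Exp198 B16Exp198TwoRun T4NestedLevels T4TwoRunRateAssembly T4MatchingClosureTwoRun
  T4MatchingClosureBirth T4GeometricLedger T4YoungHosting T4MatchingClosureHosts T4PersistentHistoryCount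
  T4MatchingClosureRecords

/-! ## §0 Origin shifts of the two weight structures; the GENERAL tail closure (`hybridNE7_closure'` minus `hlt`) -/

section Shift

variable {ι : Type*} {l₀ : ℝ} {T : ℕ → Finset ι} {A B shA shB : ℕ → ℝ → ι → ℝ} {Bad : ℕ → ℝ → Finset ι}
  {W Wsh : ℕ → ℝ}

/-- `ShellWeightBound` is stable under the origin shift `K ↦ K₀ + K` (every clause is per `K`; the shifted weights are
summable by `Summable.comp_injective`). [folklore] -/
theorem shellWeightBound_shift (K₀ : ℕ) (h : ShellWeightBound l₀ T A B shA shB Wsh) :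
    ShellWeightBound l₀ (fun K => T (K₀ + K)) (fun K => A (K₀ + K)) (fun K => B (K₀ + K)) (fun K => shA (K₀ + K))
      (fun K => shB (K₀ + K)) fun K => Wsh (K₀ + K) where
  nonneg K := h.nonneg (K₀ + K)
  summable := h.summable.comp_injective (add_right_injective K₀)
  sh_nonneg_left K := h.sh_nonneg_left (K₀ + K)
  sh_le_left K := h.sh_le_left (K₀ + K)
  sh_nonneg_right K := h.sh_nonneg_right (K₀ + K)
  sh_le_right K := h.sh_le_right (K₀ + K)
  left K := h.left (K₀ + K)
  right K := h.right (K₀ + K)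

/-- `RelWeightBound` is stable under the origin shift `K ↦ K₀ + K`. [folklore] -/
theorem relWeightBound_shift (K₀ : ℕ) (h : RelWeightBound l₀ T A B Bad W) :
    RelWeightBound l₀ (fun K => T (K₀ + K)) (fun K => A (K₀ + K)) (fun K => B (K₀ + K)) (fun K => Bad (K₀ + K))
      fun K => W (K₀ + K) where
  bad_subset K := h.bad_subset (K₀ + K)
  nonneg K := h.nonneg (K₀ + K)
  lt_one K := h.lt_one (K₀ + K)
  summable := h.summable.comp_injective (add_right_injective K₀)
  bad_left K := h.bad_left (K₀ + K)
  bad_right K := h.bad_right (K₀ + K)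

end Shift

section Tail

variable {ι : Type*} [DecidableEq ι] {l₀ vol : ℝ} {T : ℕ → Finset ι} {A B shA shB : ℕ → ℝ → ι → ℝ}
  {Bad : ℕ → ℝ → Finset ι} {Cc Rr CcRec RrRec : ℕ → ℝ → ι → ℝ} {ν u s₂ c₀ r s W Wsh : ℕ → ℝ}

/-- **THE GENERAL TAIL CLOSURE** (`T4MatchingClosure.hybridNE7_closure'` MINUS the weight condition `hlt`): ANY NE7b
datum in output shape `RelWeightBound … W`, ANY NE7c datum `ShellWeightBound … shA shB Wsh` (THE SOCKET, (S1)–(S4) of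
the module docstring), a `ReindexedBudget` on the hybrid cores `A − shA`, `B − shB` and four summable producer rates
⇒ the `K₀`-SHIFTED families carry a `HybridNE7` datum for some `K₀`.  The weight condition `W K + Wsh K < 1` holds
from some `K₀` on by `T4MatchingClosure.eventually_budget_lt_one` applied to the two structures' OWN fields
`RelWeightBound.summable`, `ShellWeightBound.summable` — nothing is asked for it (typing decision (Z3)); every other
hypothesis is shifted (§0, `T4MatchingClosure.reindexedBudget_shift`).  The head `K < K₀` needs no comparison of runs
(`T4MatchingAssembly` §4).  CONDITIONAL on its binders; nothing PRINTED is asserted. [folklore] -/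
theorem hybridNE7_closure'_tail (hW : RelWeightBound l₀ T A B Bad W) (hSh : ShellWeightBound l₀ T A B shA shB Wsh)
    (hTB : ReindexedBudget l₀ vol T (fun K t τ => A K t τ - shA K t τ) (fun K t τ => B K t τ - shB K t τ) Bad Cc Rr
      CcRec RrRec ν u s₂ c₀ r s)
    (hr : Summable r) (hu : Summable u) (hs : Summable s) (hs₂ : Summable s₂) :
    ∃ K₀, HybridNE7 l₀ vol (fun K => T (K₀ + K)) (fun K => A (K₀ + K)) (fun K => B (K₀ + K)) (fun K => Bad (K₀ + K))
      (fun K => W (K₀ + K)) (fun K => shA (K₀ + K)) (fun K => shB (K₀ + K)) (fun K => Wsh (K₀ + K))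
      (fun K => (r (K₀ + K) + u (K₀ + K)) + (s (K₀ + K) + s₂ (K₀ + K))) := by
  obtain ⟨K₀, hK₀⟩ := eventually_budget_lt_one hW.summable hSh.summable
  have hr' : Summable fun K => r (K₀ + K) := hr.comp_injective (add_right_injective K₀)
  have hu' : Summable fun K => u (K₀ + K) := hu.comp_injective (add_right_injective K₀)
  have hs' : Summable fun K => s (K₀ + K) := hs.comp_injective (add_right_injective K₀)
  have hs₂' : Summable fun K => s₂ (K₀ + K) := hs₂.comp_injective (add_right_injective K₀)
  exact ⟨K₀, hybridNE7_closure' (relWeightBound_shift K₀ hW) (shellWeightBound_shift K₀ hSh)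
    (fun K => hK₀ (K₀ + K) (Nat.le_add_right K₀ K)) (reindexedBudget_shift K₀ hTB) hr' hu' hs' hs₂'⟩

end Tail

section SchemeTail

open Missing T4Continuum T4Assembly

variable {G : Type*} [GaugeGroup G] [MeasurableSpace G] [HaarData G] {O : Type*}

/-- **PER STRING, THE GENERAL TAIL CLOSURE**: the hypotheses of `hybridNE7_closure'_tail` for the two runs' term
families read off after `K₀ + K` resp. `K₀ + K + 1` steps (E1/E2 dictionary `hZA`, `hZB`) give
`∃ K₁, StringHybridNE7 S os l₀ vol (K₀ + K₁)` — literally the per-string hypothesis of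
`T4MatchingClosureHosts.hasContinuumLimit_of_stringClosures` (packaging `T4MatchingClosure.stringHybridNE7_of_shift`).
[folklore] -/
theorem stringHybridNE7_closure'_tail (S : TorusScheme G O) (os : List O) (K₀ : ℕ) {ι : Type} [DecidableEq ι]
    {l₀ vol : ℝ} {T : ℕ → Finset ι} {A B shA shB : ℕ → ℝ → ι → ℝ} {Bad : ℕ → ℝ → Finset ι}
    {Cc Rr CcRec RrRec : ℕ → ℝ → ι → ℝ} {ν u s₂ c₀ r s W Wsh : ℕ → ℝ}
    (hW : RelWeightBound l₀ T A B Bad W) (hSh : ShellWeightBound l₀ T A B shA shB Wsh)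
    (hTB : ReindexedBudget l₀ vol T (fun K t τ => A K t τ - shA K t τ) (fun K t τ => B K t τ - shB K t τ) Bad Cc Rr
      CcRec RrRec ν u s₂ c₀ r s)
    (hr : Summable r) (hu : Summable u) (hs : Summable s) (hs₂ : Summable s₂)
    (hZA : ∀ K t, |t| ≤ l₀ → T4GenFunBounds.schemeZ S os (K₀ + K) t = ∑ τ ∈ T K, A K t τ)
    (hZB : ∀ K t, |t| ≤ l₀ → T4GenFunBounds.schemeZ S os (K₀ + K + 1) t = ∑ τ ∈ T K, B K t τ) :
    ∃ K₁, StringHybridNE7 S os l₀ vol (K₀ + K₁) := by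
  obtain ⟨K₁, h⟩ := hybridNE7_closure'_tail hW hSh hTB hr hu hs hs₂
  exact ⟨K₁, stringHybridNE7_of_shift S os K₀ K₁ h hZA hZB⟩

end SchemeTail

/-! ## §1 The socket twins of the lower chain levels: log-cut weight half, NE7b-rem rates, per-step feed -/

section Socket

variable {ι : Type*} [DecidableEq ι] {l₀ vol : ℝ} {T : ℕ → Finset ι} {A B shA shB : ℕ → ℝ → ι → ℝ}
  {Bad : ℕ → ℝ → Finset ι} {Cc Rr CcRec RrRec RrRem : ℕ → ℝ → ι → ℝ} {ν u s₂ c₀ r s u' r' Wsh : ℕ → ℝ}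
  {remOld : ℕ → ℕ → ℝ} {Λ C' E₀ ρ θ Cy E Cr : ℝ} {W : ℕ → ℕ}

/-- **NODE U5 CLOSED ON THE SOCKET, LOG-CUT WEIGHT HALF** (= `T4MatchingClosure.hybridNE7_closure_tail` with its
flattened shell block `{Acore Bcore L} hL0 hLs hA0 hAlo hAhi hB0 hBlo hBhi` REPLACED by the socket `hSh` and the budget
`hTB` typed on the hybrid cores).  Weight half (row T4-U5.E-a under I-1′): `0 < r₀ < 1`, `V ≥ 0`, `C·(−log r₀) > 1`,
non-negative terms, `SlotDom` for both runs with the log-cut budget `V·r₀^{K − jlog_C(K)}`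
(`T4MatchingClosure.relWeightBound_of_slotDom_log`); then `hybridNE7_closure'_tail`. [folklore] -/
theorem hybridNE7_closure_socket {r₀ V C : ℝ} (h0 : 0 < r₀) (h1 : r₀ < 1) (hV : 0 ≤ V) (hC : 1 < C * (-Real.log r₀))
    (hA : ∀ K t, |t| ≤ l₀ → ∀ τ ∈ T K, 0 ≤ A K t τ) (hB : ∀ K t, |t| ≤ l₀ → ∀ τ ∈ T K, 0 ≤ B K t τ)
    (hDA : SlotDom l₀ T A Bad fun K => V * r₀ ^ (K - jlogOf C K))
    (hDB : SlotDom l₀ T B Bad fun K => V * r₀ ^ (K - jlogOf C K))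
    (hSh : ShellWeightBound l₀ T A B shA shB Wsh)
    (hTB : ReindexedBudget l₀ vol T (fun K t τ => A K t τ - shA K t τ) (fun K t τ => B K t τ - shB K t τ) Bad Cc Rr
      CcRec RrRec ν u s₂ c₀ r s)
    (hr : Summable r) (hu : Summable u) (hs : Summable s) (hs₂ : Summable s₂) :
    ∃ K₀, HybridNE7 l₀ vol (fun K => T (K₀ + K)) (fun K => A (K₀ + K)) (fun K => B (K₀ + K)) (fun K => Bad (K₀ + K))
      (fun K => 1 - Real.exp (-(V * r₀ ^ (K₀ + K - jlogOf C (K₀ + K)))))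
      (fun K => shA (K₀ + K)) (fun K => shB (K₀ + K)) (fun K => Wsh (K₀ + K))
      (fun K => (r (K₀ + K) + u (K₀ + K)) + (s (K₀ + K) + s₂ (K₀ + K))) :=
  hybridNE7_closure'_tail (relWeightBound_of_slotDom_log h0 h1 hV hC hA hB hDA hDB) hSh hTB hr hu hs hs₂

/-- **… WITH NE7b-rem NAMED, YOUNG ALLOWANCE ABSTRACT** (= `T4MatchingClosureRem.hybridNE7_closure_remnantW` on the
socket): the recent-remainder rate `r′ + C_y·remnantYoungW θ Λ C W` for a sub-linear window `W` and the UV-radius rate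
`u′ + remnantOld remOld Λ C C′` under `RemnantAgeBound remOld E₀ ρ`, `1 ≤ Λ`, `0 ≤ E₀`, `0 < ρ < 1`,
`⌈C log Λ⌉₊ + 3 ≤ C′(−log ρ)`, `0 < θ < 1` are summable (`summable_add_remnantYoungW`, `summable_add_remnantOld`,
`logCutConst_nonneg`); then `hybridNE7_closure_socket`.  CONDITIONAL; nothing PRINTED is asserted. [folklore] -/
theorem hybridNE7_closure_socket_remnantW {r₀ V C : ℝ} (h0 : 0 < r₀) (h1 : r₀ < 1) (hV : 0 ≤ V)
    (hC : 1 < C * (-Real.log r₀))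
    (hA : ∀ K t, |t| ≤ l₀ → ∀ τ ∈ T K, 0 ≤ A K t τ) (hB : ∀ K t, |t| ≤ l₀ → ∀ τ ∈ T K, 0 ≤ B K t τ)
    (hDA : SlotDom l₀ T A Bad fun K => V * r₀ ^ (K - jlogOf C K))
    (hDB : SlotDom l₀ T B Bad fun K => V * r₀ ^ (K - jlogOf C K))
    (hSh : ShellWeightBound l₀ T A B shA shB Wsh)
    (hRem : RemnantAgeBound remOld E₀ ρ) (hΛ : 1 ≤ Λ) (hE : 0 ≤ E₀) (hρ0 : 0 < ρ) (hρ1 : ρ < 1)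
    (hq : ((⌈C * Real.log Λ⌉₊ : ℕ) : ℝ) + 3 ≤ C' * (-Real.log ρ)) (hθ : 0 < θ) (hθ1 : θ < 1) (hW : SublinearWindow W)
    (hTB : ReindexedBudget l₀ vol T (fun K t τ => A K t τ - shA K t τ) (fun K t τ => B K t τ - shB K t τ) Bad Cc Rr
      CcRec RrRec ν (fun K => u' K + remnantOld remOld Λ C C' K) s₂ c₀ (fun K => r' K + Cy * remnantYoungW θ Λ C W K) s)
    (hr : Summable r') (hu : Summable u') (hs : Summable s) (hs₂ : Summable s₂) :
    ∃ K₀, HybridNE7 l₀ vol (fun K => T (K₀ + K)) (fun K => A (K₀ + K)) (fun K => B (K₀ + K)) (fun K => Bad (K₀ + K))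
      (fun K => 1 - Real.exp (-(V * r₀ ^ (K₀ + K - jlogOf C (K₀ + K)))))
      (fun K => shA (K₀ + K)) (fun K => shB (K₀ + K)) (fun K => Wsh (K₀ + K))
      (fun K => ((r' (K₀ + K) + Cy * remnantYoungW θ Λ C W (K₀ + K)) +
          (u' (K₀ + K) + remnantOld remOld Λ C C' (K₀ + K))) + (s (K₀ + K) + s₂ (K₀ + K))) :=
  have hC0 : 0 ≤ C := logCutConst_nonneg h0 h1 hC
  hybridNE7_closure_socket h0 h1 hV hC hA hB hDA hDB hSh hTB (summable_add_remnantYoungW hr hθ hθ1 hΛ hC0 hW)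
    (summable_add_remnantOld hu hΛ hC0 hE hρ0 hρ1 hRem hq) hs hs₂

/-- **… FED FROM PER-STEP DATA** (= `T4MatchingClosureFed.hybridNE7_closure_fed_steps` on the socket): the budget binder
is the producer-facing `hSB : RemnantSplitBudget …` ON THE HYBRID CORES (seven clauses, remnants excluded from `u′`,
`r′`) plus the per-term step data `hsteps` (a `StepBudget` with ONE amplitude `E ≥ 0` and ONE rate constant `C_r`; then
`C_y = E·C_r`, `remOld = (fun _ n ↦ 2Eρⁿ)`, `E₀ = 2E` by `T4MatchingClosureFed.reindexedBudget_of_steps` /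
`remnantAgeBound_fed`); then `hybridNE7_closure_socket_remnantW`.  CONDITIONAL; nothing PRINTED is asserted. [folklore] -/
theorem hybridNE7_closure_socket_fed_steps {r₀ V C : ℝ} (h0 : 0 < r₀) (h1 : r₀ < 1) (hV : 0 ≤ V)
    (hC : 1 < C * (-Real.log r₀))
    (hA : ∀ K t, |t| ≤ l₀ → ∀ τ ∈ T K, 0 ≤ A K t τ) (hB : ∀ K t, |t| ≤ l₀ → ∀ τ ∈ T K, 0 ≤ B K t τ)
    (hDA : SlotDom l₀ T A Bad fun K => V * r₀ ^ (K - jlogOf C K))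
    (hDB : SlotDom l₀ T B Bad fun K => V * r₀ ^ (K - jlogOf C K))
    (hSh : ShellWeightBound l₀ T A B shA shB Wsh)
    (hΛ : 1 ≤ Λ) (hE : 0 ≤ E) (hρ0 : 0 < ρ) (hρ1 : ρ < 1)
    (hq : ((⌈C * Real.log Λ⌉₊ : ℕ) : ℝ) + 3 ≤ C' * (-Real.log ρ)) (hθ : 0 < θ) (hθ1 : θ < 1) (hW : SublinearWindow W)
    (hSB : RemnantSplitBudget l₀ vol T (fun K t τ => A K t τ - shA K t τ) (fun K t τ => B K t τ - shB K t τ) Bad Cc Rr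
      CcRec RrRec RrRem ν u' s₂ c₀ r' s)
    (hsteps : ∀ K t, |t| ≤ l₀ → ∀ τ ∈ T K \ Bad K t, ∃ rad ry Qy Qo : ℕ → ℝ,
      StepBudget C C' θ ρ E Cr vol Λ W K rad ry Qy Qo ∧ RrRem K t τ ≤ ∑ j ∈ Icc (jlogOf C K) K, rad j)
    (hr : Summable r') (hu : Summable u') (hs : Summable s) (hs₂ : Summable s₂) :
    ∃ K₀, HybridNE7 l₀ vol (fun K => T (K₀ + K)) (fun K => A (K₀ + K)) (fun K => B (K₀ + K)) (fun K => Bad (K₀ + K))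
      (fun K => 1 - Real.exp (-(V * r₀ ^ (K₀ + K - jlogOf C (K₀ + K)))))
      (fun K => shA (K₀ + K)) (fun K => shB (K₀ + K)) (fun K => Wsh (K₀ + K))
      (fun K => ((r' (K₀ + K) + (E * Cr) * remnantYoungW θ Λ C W (K₀ + K)) +
          (u' (K₀ + K) + remnantOld (fun _ n => 2 * E * ρ ^ n) Λ C C' (K₀ + K))) + (s (K₀ + K) + s₂ (K₀ + K))) :=
  hybridNE7_closure_socket_remnantW h0 h1 hV hC hA hB hDA hDB hSh (remnantAgeBound_fed hE hρ0.le) hΛ (by positivity)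
    hρ0 hρ1 hq hθ hθ1 hW (reindexedBudget_of_steps hSB hE hρ0.le hsteps) hr hu hs hs₂

end Socket

/-! ## §2 The socket twin at producer level on the remnant side (`hsteps` discharged, as in `T4MatchingClosureHosts`) -/

section SocketHosts

variable {ι : Type*} [DecidableEq ι] {l₀ vol : ℝ} {T : ℕ → Finset ι} {A B shA shB : ℕ → ℝ → ι → ℝ}
  {Bad : ℕ → ℝ → Finset ι} {Cc Rr CcRec RrRec RrRem : ℕ → ℝ → ι → ℝ} {ν u' s₂ c₀ r' s Wsh : ℕ → ℝ}
  {Λ C' ρ θ Cr x c : ℝ} {dd Lb rr : ℕ}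
variable {Dom Cube : ℕ → Type*} [∀ K, DecidableEq (Dom K)] [∀ K, DecidableEq (Cube K)]
  (inc : (K : ℕ) → Dom K → Dom K → Prop) [∀ K, DecidableRel (inc K)] [∀ K, Fintype (Dom K)]
  [∀ K, Std.Refl (inc K)] [∀ K, Std.Symm (inc K)]
  {κ η : Type*} [DecidableEq κ] [DecidableEq η] {ιL Op : Type*} [DecidableEq ιL]

/-- **NODE U5 CLOSED ON THE SOCKET AT PRODUCER LEVEL, REMNANT SIDE** (= `T4MatchingClosureHosts.hybridNE7_closure_hosts`
with its flattened shell block `{Acore Bcore L} hL0 hLs hA0 hAlo hAhi hB0 hBlo hBhi` REPLACED by the general NE7c socket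
`hSh : ShellWeightBound l₀ T A B shA shB Wsh` ((S1)–(S4) of the module docstring) and the split budget `hSB` typed on
the hybrid cores `A − shA`, `B − shB`; EVERY OTHER BINDER is `hybridNE7_closure_hosts`' verbatim, in its order, and the
proof is its proof with the callee exchanged: Lemma Y's window `T4MatchingClosureYoung.sublinearWindow_youngWindow_of_hq`,
`hsteps` discharged per good term by ONE application of `T4YoungHosting.steps_feed_of_twoRun_bankYoung (inc K)`, then
`hybridNE7_closure_socket_fed_steps`).  CONDITIONAL; nothing PRINTED is asserted; nothing instantiated. [folklore] -/
theorem hybridNE7_closure_socket_hosts {r₀ V C : ℝ} (h0 : 0 < r₀) (h1 : r₀ < 1) (hV : 0 ≤ V)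
    (hC : 1 < C * (-Real.log r₀))
    (hA : ∀ K t, |t| ≤ l₀ → ∀ τ ∈ T K, 0 ≤ A K t τ) (hB : ∀ K t, |t| ≤ l₀ → ∀ τ ∈ T K, 0 ≤ B K t τ)
    (hDA : SlotDom l₀ T A Bad fun K => V * r₀ ^ (K - jlogOf C K))
    (hDB : SlotDom l₀ T B Bad fun K => V * r₀ ^ (K - jlogOf C K))
    -- ─── in the slot of the flattened shell block: THE GENERAL NE7c SOCKET, (S1)–(S4) ───
    (hSh : ShellWeightBound l₀ T A B shA shB Wsh)
    (hΛ : 1 ≤ Λ) (hρ0 : 0 < ρ) (hρ1 : ρ < 1)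
    (hq : ((⌈C * Real.log Λ⌉₊ : ℕ) : ℝ) + 3 ≤ C' * (-Real.log ρ)) (hθ : 0 < θ) (hθ1 : θ < 1) (hCr : 0 ≤ Cr)
    (hx : 0 ≤ x) (hc : 0 ≤ c)
    (hSB : RemnantSplitBudget l₀ vol T (fun K t τ => A K t τ - shA K t τ) (fun K t τ => B K t τ - shB K t τ) Bad
      Cc Rr CcRec RrRec RrRem ν u' s₂ c₀ r' s)
    -- ─── in the slot of `hsteps`: the producer's binders (uniform / per cutoff / per term) ───
    {Akp Rkp r₁ skp κ₀ Kkp c₁ bkp τkp νkp : ℝ}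
    (hAkp : 0 ≤ Akp) (hKkp : 0 ≤ Kkp) (hτkp : 0 ≤ τkp) (hr₁ : 0 ≤ r₁) (hskp : 0 ≤ skp) (hbkp : 0 ≤ bkp)
    (hrate' : κ₀ + (r₁ + skp) + τkp * c₁ ≤ Rkp) (hsmall : Akp * Real.exp (bkp + τkp * c₁) * Kkp * νkp ≤ τkp)
    (hdd : 1 ≤ dd) {ce cs p₀ : ℝ} (hce : 0 < ce) (hp : 0 < p₀) (hP5 : ce ≤ cs * p₀)
    (F : ℕ → Flow) {β' : ℝ} (hβ' : 0 ≤ β') (hL : 1 ≤ Lb)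
    (hpos : ∀ K j, j ≤ K → 0 < (F K).g j) (hle1 : ∀ K j, j ≤ K → (F K).g j ≤ 1) (hrg : ∀ K, (F K).SatisfiesRG K)
    (hub : ∀ K j, j < K → (F K).β (j + 1) ((F K).g j) ≤ β') (Rw : ℕ → ℕ → ℕ)
    (hRj : ∀ K j, j ≤ K → B14.IsRj Lb rr ((F K).g j) (Rw K j))
    (hxK : ∀ K, Real.log (((F K).g K) ^ 2)⁻¹ ≤ x) (hcK : ∀ K, ((F K).g K) ^ 2 * β' ≤ c)
    {Nsz : ℕ} (hNsz : 64 ≤ Nsz)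
    {Cat Disc : (K : ℕ) → ℝ → ι → ℕ → Finset (Dom K)}
    {cubes out reach : (K : ℕ) → ℝ → ι → ℕ → Dom K → Finset (Cube K)} {dsz : (K : ℕ) → ℝ → ι → ℕ → Dom K → ℝ}
    {wA wB : (K : ℕ) → ℝ → ι → ℕ → Dom K → ℂ}
    (Gl : (K : ℕ) → ℝ → ι → ℕ → Dom K → GeoLedger dd κ η) (birth : (K : ℕ) → ℝ → ι → ℕ → Dom K → ℕ)
    (Clean : (K : ℕ) → ℝ → ι → ℕ → Dom K → ℕ → ℕ → Prop) {Qy Qo : (K : ℕ) → ℝ → ι → ℕ → Finset (Cube K)}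
    (led : ℕ → ℝ → ι → Ledger ιL Op) (rem : ℕ → ℝ → ι → ℕ → Finset ιL)
    (dom : (K : ℕ) → ℝ → ι → ιL → Finset (Cube K))
    (hDisc : ∀ K t, |t| ≤ l₀ → ∀ τ ∈ T K \ Bad K t, ∀ j, Disc K t τ j ⊆ Cat K t τ j)
    (hloc : ∀ K t, |t| ≤ l₀ → ∀ τ ∈ T K \ Bad K t,
      ∀ j Z, ∀ Z' ∈ Cat K t τ j, inc K Z' Z → ∃ q ∈ reach K t τ j Z, q ∈ out K t τ j Z')
    (hreach : ∀ K t, |t| ≤ l₀ → ∀ τ ∈ T K \ Bad K t,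
      ∀ j Z, ((reach K t τ j Z).card : ℝ) ≤ νkp * (out K t τ j Z).card)
    (hdsz : ∀ K t, |t| ≤ l₀ → ∀ τ ∈ T K \ Bad K t, ∀ j Z, 0 ≤ dsz K t τ j Z)
    (hwAΛ : ∀ K t, |t| ≤ l₀ → ∀ τ ∈ T K \ Bad K t, ∀ j Z, Z ∉ Cat K t τ j → wA K t τ j Z = 0)
    (hwBΛ : ∀ K t, |t| ≤ l₀ → ∀ τ ∈ T K \ Bad K t, ∀ j Z, Z ∉ Cat K t τ j → wB K t τ j Z = 0)
    (hwA : ∀ K t, |t| ≤ l₀ → ∀ τ ∈ T K \ Bad K t,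
      ∀ j Z, ‖wA K t τ j Z‖ ≤ Akp * Real.exp (-(Rkp * dsz K t τ j Z)))
    (hwB : ∀ K t, |t| ≤ l₀ → ∀ τ ∈ T K \ Bad K t,
      ∀ j Z, ‖wB K t τ j Z‖ ≤ Akp * Real.exp (-(Rkp * dsz K t τ j Z)))
    (hzero : ∀ K t, |t| ≤ l₀ → ∀ τ ∈ T K \ Bad K t,
      ∀ j, ∀ Z ∈ Cat K t τ j, Z ∉ Disc K t τ j → wA K t τ j Z = wB K t τ j Z)
    (hbirth : ∀ K t, |t| ≤ l₀ → ∀ τ ∈ T K \ Bad K t, ∀ j ∈ Icc (jlogOf C K) K, ∀ Z ∈ Disc K t τ j,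
      BankYoung₂ (Gl K t τ j Z) ce cs p₀ C' K →
        ‖wA K t τ j Z - wB K t τ j Z‖ ≤ Cr * θ ^ birth K t τ j Z * (Akp * Real.exp (-(Rkp * dsz K t τ j Z))))
    (hhost : ∀ K t, |t| ≤ l₀ → ∀ τ ∈ T K \ Bad K t, ∀ j ∈ Icc (jlogOf C K) K, ∀ Z ∈ Disc K t τ j,
      BankYoung₂ (Gl K t τ j Z) ce cs p₀ C' K →
        Hosts (Gl K t τ j Z) (birth K t τ j Z) j Nsz (Rw K) (Clean K t τ j Z))
    (hsizeA : ∀ K t, |t| ≤ l₀ → ∀ τ ∈ T K \ Bad K t, ∀ j ∈ Icc (jlogOf C K) K, ∀ Z ∈ Disc K t τ j,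
      ¬BankYoung₂ (Gl K t τ j Z) ce cs p₀ C' K →
        ‖wA K t τ j Z‖ ≤ ρ ^ ageCut C' K * (Akp * Real.exp (-(Rkp * dsz K t τ j Z))))
    (hsizeB : ∀ K t, |t| ≤ l₀ → ∀ τ ∈ T K \ Bad K t, ∀ j ∈ Icc (jlogOf C K) K, ∀ Z ∈ Disc K t τ j,
      ¬BankYoung₂ (Gl K t τ j Z) ce cs p₀ C' K →
        ‖wB K t τ j Z‖ ≤ ρ ^ ageCut C' K * (Akp * Real.exp (-(Rkp * dsz K t τ j Z))))
    (h126 : ∀ K t, |t| ≤ l₀ → ∀ τ ∈ T K \ Bad K t, ∀ j, Ineq126 (Cat K t τ j) (out K t τ j) (dsz K t τ j) κ₀ Kkp)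
    (hvol : ∀ K t, |t| ≤ l₀ → ∀ τ ∈ T K \ Bad K t, ∀ j, VolBound (Cat K t τ j) (out K t τ j) (dsz K t τ j) c₁)
    (hQy : ∀ K t, |t| ≤ l₀ → ∀ τ ∈ T K \ Bad K t, ∀ j ∈ Icc (jlogOf C K) K, ∀ Z ∈ Disc K t τ j,
      BankYoung₂ (Gl K t τ j Z) ce cs p₀ C' K → ∃ q ∈ Qy K t τ j, q ∈ out K t τ j Z)
    (hQo : ∀ K t, |t| ≤ l₀ → ∀ τ ∈ T K \ Bad K t, ∀ j ∈ Icc (jlogOf C K) K, ∀ Z ∈ Disc K t τ j,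
      ¬BankYoung₂ (Gl K t τ j Z) ce cs p₀ C' K → ∃ q ∈ Qo K t τ j, q ∈ out K t τ j Z)
    (hQyc : ∀ K t, |t| ≤ l₀ → ∀ τ ∈ T K \ Bad K t,
      ∀ j ∈ Icc (jlogOf C K) K, ((Qy K t τ j).card : ℝ) ≤ vol * Λ ^ (K - j))
    (hQoc : ∀ K t, |t| ≤ l₀ → ∀ τ ∈ T K \ Bad K t,
      ∀ j ∈ Icc (jlogOf C K) K, ((Qo K t τ j).card : ℝ) ≤ vol * Λ ^ (K - j))
    (hnd : ∀ K t, |t| ≤ l₀ → ∀ τ ∈ T K \ Bad K t, (led K t τ).leaves.Nodup)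
    (hinj : ∀ K t, |t| ≤ l₀ → ∀ τ ∈ T K \ Bad K t, ∀ j, Set.InjOn (dom K t τ) ↑(rem K t τ j))
    (hRem : ∀ K t, |t| ≤ l₀ → ∀ τ ∈ T K \ Bad K t,
      RrRem K t τ ≤ ∑ j ∈ Icc (jlogOf C K) K, (led K t τ).leafSum fun i => if i ∈ rem K t τ j then
        ‖locR (inc K) (Cat K t τ j) (cubes K t τ j) (wA K t τ j) (dom K t τ i) -
          locR (inc K) (Cat K t τ j) (cubes K t τ j) (wB K t τ j) (dom K t τ i)‖ else 0)
    -- ─── the consumer's tail ───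
    (hr : Summable r') (hu : Summable u') (hs : Summable s) (hs₂ : Summable s₂) :
    ∃ K₀, HybridNE7 l₀ vol (fun K => T (K₀ + K)) (fun K => A (K₀ + K)) (fun K => B (K₀ + K)) (fun K => Bad (K₀ + K))
      (fun K => 1 - Real.exp (-(V * r₀ ^ (K₀ + K - jlogOf C (K₀ + K)))))
      (fun K => shA (K₀ + K)) (fun K => shB (K₀ + K)) (fun K => Wsh (K₀ + K))
      (fun K => ((r' (K₀ + K) + ((Akp * Real.exp (bkp + τkp * c₁) * Kkp) * Cr) *
            remnantYoungW θ Λ C (youngWindow dd Lb rr (T4EpochSize.modelC dd) C' x c) (K₀ + K)) +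
          (u' (K₀ + K) + remnantOld (fun _ n => 2 * (Akp * Real.exp (bkp + τkp * c₁) * Kkp) * ρ ^ n) Λ C C'
            (K₀ + K))) + (s (K₀ + K) + s₂ (K₀ + K))) :=
  hybridNE7_closure_socket_fed_steps h0 h1 hV hC hA hB hDA hDB hSh hΛ
    (mul_nonneg (mul_nonneg hAkp (Real.exp_pos _).le) hKkp) hρ0 hρ1 hq hθ hθ1
    (sublinearWindow_youngWindow_of_hq dd Lb rr hρ0 hρ1 hq (T4EpochSize.one_le_modelC dd) hx hc) hSB
    (fun K t ht τ hτ =>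
      steps_feed_of_twoRun_bankYoung (inc K) hθ hθ1.le hCr (hDisc K t ht τ hτ) (hloc K t ht τ hτ)
        (hreach K t ht τ hτ) (hdsz K t ht τ hτ) hAkp hKkp hτkp hρ0.le hr₁ hskp hbkp (hwAΛ K t ht τ hτ)
        (hwBΛ K t ht τ hτ) (hwA K t ht τ hτ) (hwB K t ht τ hτ) (hzero K t ht τ hτ) hdd (Gl K t τ) hce hp hP5
        (birth K t τ) (hbirth K t ht τ hτ) (F K) hβ' hL (hpos K) (hle1 K) (hrg K) (hub K) (Rw K) (hRj K) hx hc
        (hxK K) (hcK K) hNsz (Clean K t τ) (hhost K t ht τ hτ) (hsizeA K t ht τ hτ) (hsizeB K t ht τ hτ)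
        (h126 K t ht τ hτ) (hvol K t ht τ hτ) hrate' hsmall (hQy K t ht τ hτ) (hQo K t ht τ hτ) (hQyc K t ht τ hτ)
        (hQoc K t ht τ hτ) (hnd K t ht τ hτ) (rem K t τ) (hinj K t ht τ hτ) (hRem K t ht τ hτ))
    hr hu hs hs₂

end SocketHosts

/-! ## §3 The socket twin at producer level on the NE7b side too (`hDA`, `hDB` discharged, as in
`T4MatchingClosureRecords`); per string, end to end -/

section SocketRecords

variable {ι : Type*} [DecidableEq ι] {l₀ vol : ℝ} {T : ℕ → Finset ι} {A B shA shB : ℕ → ℝ → ι → ℝ}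
  {Bad : ℕ → ℝ → Finset ι} {Cc Rr CcRec RrRec RrRem : ℕ → ℝ → ι → ℝ} {ν u' s₂ c₀ r' s Wsh : ℕ → ℝ}
  {Λ C' ρ θ Cr x c : ℝ} {dd Lb rr : ℕ}
variable {Dom Cube : ℕ → Type*} [∀ K, DecidableEq (Dom K)] [∀ K, DecidableEq (Cube K)]
  (inc : (K : ℕ) → Dom K → Dom K → Prop) [∀ K, DecidableRel (inc K)] [∀ K, Fintype (Dom K)]
  [∀ K, Std.Refl (inc K)] [∀ K, Std.Symm (inc K)]
  {κ η : Type*} [DecidableEq κ] [DecidableEq η] {ιL Op : Type*} [DecidableEq ιL]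

/-- **NODE U5 CLOSED ON THE SOCKET AT PRODUCER LEVEL ON THE NE7b SIDE TOO**
(= `T4MatchingClosureRecords.hybridNE7_closure_records` with its flattened shell block REPLACED by the general NE7c
socket `hSh : ShellWeightBound l₀ T A B shA shB Wsh` and `hSB` typed on the hybrid cores; every other binder — the rate
constants `V Λ_c κ₁ ρ̄ η̄` with signs, `hσ`, the log cut `hC`, the two runs' persistence RECORD MODELS in the slots of
`hDA` / `hDB`, the remnant-side producer block, the four summable rates — verbatim, in the landed order; the proof is
the landed one with the callee exchanged for `hybridNE7_closure_socket_hosts`).  THE USER-FACING HYBRID-LEVEL BINDER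
LIST OF NODE U5 WITH THE NE7c SIDE A SOCKET: any producer of `ShellWeightBound` — design (i)
(`T4ShellMeasure.shellWeightBound_of_realized`), the flattened nested shells (`T4NestedShells.shellWeightBound_of_flattened`,
§4), design (η) (`T4LipschitzLedger.shellWeightBound_of_repr`) — plugs `hSh` BY NAME.  CONDITIONAL; nothing PRINTED is
asserted; nothing instantiated. [folklore] -/
theorem hybridNE7_closure_socket_records
    {C : ℝ} {γA εA γB εB : Type*} [DecidableEq γA] [DecidableEq εA] [DecidableEq γB] [DecidableEq εB]
    {V Λc κ₁ ρbar ηbar : ℝ} (hV : 0 ≤ V) (hΛc : 0 < Λc) (hκ : 0 ≤ κ₁) (hσ : Λc * Real.exp (ηbar - κ₁) < 1)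
    (hC : 1 < C * (-Real.log (Λc * Real.exp (ηbar - κ₁))))
    (hA : ∀ K t, |t| ≤ l₀ → ∀ τ ∈ T K, 0 ≤ A K t τ) (hB : ∀ K t, |t| ≤ l₀ → ∀ τ ∈ T K, 0 ≤ B K t τ)
    -- ─── in the slot of `hDA`: run A's persistence RECORD MODEL (`T4PersistentHistoryCount` §1–§3) ───
    (CellA : ℕ → ℕ → Finset γA) (hcellA : ∀ K a, ((CellA K a).card : ℝ) ≤ V * Λc ^ a)
    (WA stepA : εA → ℕ) (EA BkA : ℕ → ℕ → Finset εA) (hEA : ∀ K j, ∀ e ∈ EA K j, stepA e ∈ Ioc j K)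
    (ρA : εA → ℝ) (hρA : ∀ K j, ∀ b ∈ BkA K j, 0 ≤ ρA b) (hρbarA : ∀ K j, ∑ b ∈ BkA K j, ρA b ≤ ρbar)
    (ηA : εA → ℝ) (hηA : ∀ K j, ∀ e ∈ EA K j, 0 ≤ ηA e)
    (hηbarA : ∀ K j, ∀ n ∈ Ioc j K, ∑ e ∈ EA K j with stepA e = n, ηA e ≤ ηbar)
    (hdomA : ∀ K t, |t| ≤ l₀ → ∃ (n : ℕ) (Φ : SwitchOff (T K) n) (bth : Fin n → ℕ) (cell : Fin n → γA)
        (y : Fin n → εA → Finset εA → ℝ),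
      Bad K t = Φ.bad ∧ (∀ i, bth i < jlogOf C K) ∧ (∀ i, cell i ∈ CellA K (K - bth i)) ∧
      Function.Injective (fun i => (⟨bth i, cell i⟩ : Σ _ : ℕ, γA)) ∧
      (∀ i, ∀ b ∈ BkA K (bth i), ∀ Q ∈ records WA (bth i) K (EA K (bth i)) b, 0 ≤ y i b Q) ∧
      (∀ i, ∀ b ∈ BkA K (bth i), ∀ Q ∈ records WA (bth i) K (EA K (bth i)) b,
        y i b Q ≤ ρA b * Real.exp (-(κ₁ * WA b)) * ∏ e ∈ Q, (Real.exp (-(κ₁ * WA e)) * ηA e)) ∧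
      ∀ i : Fin n, ∀ τ'' ∈ T K, Φ.pend i τ'' = false →
        ∑ τ ∈ T K with (Φ.pend i τ = true ∧ Φ.off i τ = τ''), A K t τ ≤
          (∑ b ∈ BkA K (bth i), ∑ Q ∈ records WA (bth i) K (EA K (bth i)) b, y i b Q) * A K t τ'')
    -- ─── in the slot of `hDB`: run B's persistence RECORD MODEL (`T4PersistentHistoryCount` §1–§3) ───
    (CellB : ℕ → ℕ → Finset γB) (hcellB : ∀ K a, ((CellB K a).card : ℝ) ≤ V * Λc ^ a)
    (WB stepB : εB → ℕ) (EB BkB : ℕ → ℕ → Finset εB) (hEB : ∀ K j, ∀ e ∈ EB K j, stepB e ∈ Ioc j K)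
    (ρB : εB → ℝ) (hρB : ∀ K j, ∀ b ∈ BkB K j, 0 ≤ ρB b) (hρbarB : ∀ K j, ∑ b ∈ BkB K j, ρB b ≤ ρbar)
    (ηB : εB → ℝ) (hηB : ∀ K j, ∀ e ∈ EB K j, 0 ≤ ηB e)
    (hηbarB : ∀ K j, ∀ n ∈ Ioc j K, ∑ e ∈ EB K j with stepB e = n, ηB e ≤ ηbar)
    (hdomB : ∀ K t, |t| ≤ l₀ → ∃ (n : ℕ) (Φ : SwitchOff (T K) n) (bth : Fin n → ℕ) (cell : Fin n → γB)
        (y : Fin n → εB → Finset εB → ℝ),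
      Bad K t = Φ.bad ∧ (∀ i, bth i < jlogOf C K) ∧ (∀ i, cell i ∈ CellB K (K - bth i)) ∧
      Function.Injective (fun i => (⟨bth i, cell i⟩ : Σ _ : ℕ, γB)) ∧
      (∀ i, ∀ b ∈ BkB K (bth i), ∀ Q ∈ records WB (bth i) K (EB K (bth i)) b, 0 ≤ y i b Q) ∧
      (∀ i, ∀ b ∈ BkB K (bth i), ∀ Q ∈ records WB (bth i) K (EB K (bth i)) b,
        y i b Q ≤ ρB b * Real.exp (-(κ₁ * WB b)) * ∏ e ∈ Q, (Real.exp (-(κ₁ * WB e)) * ηB e)) ∧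
      ∀ i : Fin n, ∀ τ'' ∈ T K, Φ.pend i τ'' = false →
        ∑ τ ∈ T K with (Φ.pend i τ = true ∧ Φ.off i τ = τ''), B K t τ ≤
          (∑ b ∈ BkB K (bth i), ∑ Q ∈ records WB (bth i) K (EB K (bth i)) b, y i b Q) * B K t τ'')
    -- ─── in the slot of the flattened shell block: THE GENERAL NE7c SOCKET, (S1)–(S4) ───
    (hSh : ShellWeightBound l₀ T A B shA shB Wsh)
    (hΛ : 1 ≤ Λ) (hρ0 : 0 < ρ) (hρ1 : ρ < 1)
    (hq : ((⌈C * Real.log Λ⌉₊ : ℕ) : ℝ) + 3 ≤ C' * (-Real.log ρ)) (hθ : 0 < θ) (hθ1 : θ < 1) (hCr : 0 ≤ Cr)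
    (hx : 0 ≤ x) (hc : 0 ≤ c)
    (hSB : RemnantSplitBudget l₀ vol T (fun K t τ => A K t τ - shA K t τ) (fun K t τ => B K t τ - shB K t τ) Bad
      Cc Rr CcRec RrRec RrRem ν u' s₂ c₀ r' s)
    -- ─── in the slot of `hsteps`: the producer's binders (uniform / per cutoff / per term) ───
    {Akp Rkp r₁ skp κ₀ Kkp c₁ bkp τkp νkp : ℝ}
    (hAkp : 0 ≤ Akp) (hKkp : 0 ≤ Kkp) (hτkp : 0 ≤ τkp) (hr₁ : 0 ≤ r₁) (hskp : 0 ≤ skp) (hbkp : 0 ≤ bkp)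
    (hrate' : κ₀ + (r₁ + skp) + τkp * c₁ ≤ Rkp) (hsmall : Akp * Real.exp (bkp + τkp * c₁) * Kkp * νkp ≤ τkp)
    (hdd : 1 ≤ dd) {ce cs p₀ : ℝ} (hce : 0 < ce) (hp : 0 < p₀) (hP5 : ce ≤ cs * p₀)
    (F : ℕ → Flow) {β' : ℝ} (hβ' : 0 ≤ β') (hL : 1 ≤ Lb)
    (hpos : ∀ K j, j ≤ K → 0 < (F K).g j) (hle1 : ∀ K j, j ≤ K → (F K).g j ≤ 1) (hrg : ∀ K, (F K).SatisfiesRG K)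
    (hub : ∀ K j, j < K → (F K).β (j + 1) ((F K).g j) ≤ β') (Rw : ℕ → ℕ → ℕ)
    (hRj : ∀ K j, j ≤ K → B14.IsRj Lb rr ((F K).g j) (Rw K j))
    (hxK : ∀ K, Real.log (((F K).g K) ^ 2)⁻¹ ≤ x) (hcK : ∀ K, ((F K).g K) ^ 2 * β' ≤ c)
    {Nsz : ℕ} (hNsz : 64 ≤ Nsz)
    {Cat Disc : (K : ℕ) → ℝ → ι → ℕ → Finset (Dom K)}
    {cubes out reach : (K : ℕ) → ℝ → ι → ℕ → Dom K → Finset (Cube K)} {dsz : (K : ℕ) → ℝ → ι → ℕ → Dom K → ℝ}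
    {wA wB : (K : ℕ) → ℝ → ι → ℕ → Dom K → ℂ}
    (Gl : (K : ℕ) → ℝ → ι → ℕ → Dom K → GeoLedger dd κ η) (birth : (K : ℕ) → ℝ → ι → ℕ → Dom K → ℕ)
    (Clean : (K : ℕ) → ℝ → ι → ℕ → Dom K → ℕ → ℕ → Prop) {Qy Qo : (K : ℕ) → ℝ → ι → ℕ → Finset (Cube K)}
    (led : ℕ → ℝ → ι → Ledger ιL Op) (rem : ℕ → ℝ → ι → ℕ → Finset ιL)
    (dom : (K : ℕ) → ℝ → ι → ιL → Finset (Cube K))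
    (hDisc : ∀ K t, |t| ≤ l₀ → ∀ τ ∈ T K \ Bad K t, ∀ j, Disc K t τ j ⊆ Cat K t τ j)
    (hloc : ∀ K t, |t| ≤ l₀ → ∀ τ ∈ T K \ Bad K t,
      ∀ j Z, ∀ Z' ∈ Cat K t τ j, inc K Z' Z → ∃ q ∈ reach K t τ j Z, q ∈ out K t τ j Z')
    (hreach : ∀ K t, |t| ≤ l₀ → ∀ τ ∈ T K \ Bad K t,
      ∀ j Z, ((reach K t τ j Z).card : ℝ) ≤ νkp * (out K t τ j Z).card)
    (hdsz : ∀ K t, |t| ≤ l₀ → ∀ τ ∈ T K \ Bad K t, ∀ j Z, 0 ≤ dsz K t τ j Z)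
    (hwAΛ : ∀ K t, |t| ≤ l₀ → ∀ τ ∈ T K \ Bad K t, ∀ j Z, Z ∉ Cat K t τ j → wA K t τ j Z = 0)
    (hwBΛ : ∀ K t, |t| ≤ l₀ → ∀ τ ∈ T K \ Bad K t, ∀ j Z, Z ∉ Cat K t τ j → wB K t τ j Z = 0)
    (hwA : ∀ K t, |t| ≤ l₀ → ∀ τ ∈ T K \ Bad K t,
      ∀ j Z, ‖wA K t τ j Z‖ ≤ Akp * Real.exp (-(Rkp * dsz K t τ j Z)))
    (hwB : ∀ K t, |t| ≤ l₀ → ∀ τ ∈ T K \ Bad K t,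
      ∀ j Z, ‖wB K t τ j Z‖ ≤ Akp * Real.exp (-(Rkp * dsz K t τ j Z)))
    (hzero : ∀ K t, |t| ≤ l₀ → ∀ τ ∈ T K \ Bad K t,
      ∀ j, ∀ Z ∈ Cat K t τ j, Z ∉ Disc K t τ j → wA K t τ j Z = wB K t τ j Z)
    (hbirth : ∀ K t, |t| ≤ l₀ → ∀ τ ∈ T K \ Bad K t, ∀ j ∈ Icc (jlogOf C K) K, ∀ Z ∈ Disc K t τ j,
      BankYoung₂ (Gl K t τ j Z) ce cs p₀ C' K →
        ‖wA K t τ j Z - wB K t τ j Z‖ ≤ Cr * θ ^ birth K t τ j Z * (Akp * Real.exp (-(Rkp * dsz K t τ j Z))))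
    (hhost : ∀ K t, |t| ≤ l₀ → ∀ τ ∈ T K \ Bad K t, ∀ j ∈ Icc (jlogOf C K) K, ∀ Z ∈ Disc K t τ j,
      BankYoung₂ (Gl K t τ j Z) ce cs p₀ C' K →
        Hosts (Gl K t τ j Z) (birth K t τ j Z) j Nsz (Rw K) (Clean K t τ j Z))
    (hsizeA : ∀ K t, |t| ≤ l₀ → ∀ τ ∈ T K \ Bad K t, ∀ j ∈ Icc (jlogOf C K) K, ∀ Z ∈ Disc K t τ j,
      ¬BankYoung₂ (Gl K t τ j Z) ce cs p₀ C' K →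
        ‖wA K t τ j Z‖ ≤ ρ ^ ageCut C' K * (Akp * Real.exp (-(Rkp * dsz K t τ j Z))))
    (hsizeB : ∀ K t, |t| ≤ l₀ → ∀ τ ∈ T K \ Bad K t, ∀ j ∈ Icc (jlogOf C K) K, ∀ Z ∈ Disc K t τ j,
      ¬BankYoung₂ (Gl K t τ j Z) ce cs p₀ C' K →
        ‖wB K t τ j Z‖ ≤ ρ ^ ageCut C' K * (Akp * Real.exp (-(Rkp * dsz K t τ j Z))))
    (h126 : ∀ K t, |t| ≤ l₀ → ∀ τ ∈ T K \ Bad K t, ∀ j, Ineq126 (Cat K t τ j) (out K t τ j) (dsz K t τ j) κ₀ Kkp)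
    (hvol : ∀ K t, |t| ≤ l₀ → ∀ τ ∈ T K \ Bad K t, ∀ j, VolBound (Cat K t τ j) (out K t τ j) (dsz K t τ j) c₁)
    (hQy : ∀ K t, |t| ≤ l₀ → ∀ τ ∈ T K \ Bad K t, ∀ j ∈ Icc (jlogOf C K) K, ∀ Z ∈ Disc K t τ j,
      BankYoung₂ (Gl K t τ j Z) ce cs p₀ C' K → ∃ q ∈ Qy K t τ j, q ∈ out K t τ j Z)
    (hQo : ∀ K t, |t| ≤ l₀ → ∀ τ ∈ T K \ Bad K t, ∀ j ∈ Icc (jlogOf C K) K, ∀ Z ∈ Disc K t τ j,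
      ¬BankYoung₂ (Gl K t τ j Z) ce cs p₀ C' K → ∃ q ∈ Qo K t τ j, q ∈ out K t τ j Z)
    (hQyc : ∀ K t, |t| ≤ l₀ → ∀ τ ∈ T K \ Bad K t,
      ∀ j ∈ Icc (jlogOf C K) K, ((Qy K t τ j).card : ℝ) ≤ vol * Λ ^ (K - j))
    (hQoc : ∀ K t, |t| ≤ l₀ → ∀ τ ∈ T K \ Bad K t,
      ∀ j ∈ Icc (jlogOf C K) K, ((Qo K t τ j).card : ℝ) ≤ vol * Λ ^ (K - j))
    (hnd : ∀ K t, |t| ≤ l₀ → ∀ τ ∈ T K \ Bad K t, (led K t τ).leaves.Nodup)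
    (hinj : ∀ K t, |t| ≤ l₀ → ∀ τ ∈ T K \ Bad K t, ∀ j, Set.InjOn (dom K t τ) ↑(rem K t τ j))
    (hRem : ∀ K t, |t| ≤ l₀ → ∀ τ ∈ T K \ Bad K t,
      RrRem K t τ ≤ ∑ j ∈ Icc (jlogOf C K) K, (led K t τ).leafSum fun i => if i ∈ rem K t τ j then
        ‖locR (inc K) (Cat K t τ j) (cubes K t τ j) (wA K t τ j) (dom K t τ i) -
          locR (inc K) (Cat K t τ j) (cubes K t τ j) (wB K t τ j) (dom K t τ i)‖ else 0)
    -- ─── the consumer's tail ───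
    (hr : Summable r') (hu : Summable u') (hs : Summable s) (hs₂ : Summable s₂) :
    ∃ K₀, HybridNE7 l₀ vol (fun K => T (K₀ + K)) (fun K => A (K₀ + K)) (fun K => B (K₀ + K)) (fun K => Bad (K₀ + K))
      (fun K => 1 - Real.exp (-(ρbar * Real.exp (-κ₁) * V * (Λc * Real.exp (ηbar - κ₁)) / (1 - Λc * Real.exp (ηbar - κ₁)) *
        (Λc * Real.exp (ηbar - κ₁)) ^ (K₀ + K - jlogOf C (K₀ + K)))))
      (fun K => shA (K₀ + K)) (fun K => shB (K₀ + K)) (fun K => Wsh (K₀ + K))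
      (fun K => ((r' (K₀ + K) + ((Akp * Real.exp (bkp + τkp * c₁) * Kkp) * Cr) *
            remnantYoungW θ Λ C (youngWindow dd Lb rr (T4EpochSize.modelC dd) C' x c) (K₀ + K)) +
          (u' (K₀ + K) + remnantOld (fun _ n => 2 * (Akp * Real.exp (bkp + τkp * c₁) * Kkp) * ρ ^ n) Λ C C'
            (K₀ + K))) + (s (K₀ + K) + s₂ (K₀ + K))) := by
  have hr0 : 0 < Λc * Real.exp (ηbar - κ₁) := mul_pos hΛc (Real.exp_pos _)
  have hρbar : 0 ≤ ρbar := (sum_nonneg (hρA 0 0)).trans (hρbarA 0 0)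
  exact hybridNE7_closure_socket_hosts inc hr0 hσ (twoRateV_nonneg (mul_nonneg hρbar (Real.exp_pos _).le) hV hr0.le hσ) hC hA hB
    (slotDom_congr
      (slotDom_of_records CellA hV hΛc.le hcellA WA stepA EA BkA hEA hκ ρA hρA hρbarA ηA hηA hηbarA hσ (jlogOf C)
        (jlogOf_le C) hdomA)
      (twoRate_budget_eq (ρbar * Real.exp (-κ₁)) V (Λc * Real.exp (ηbar - κ₁)) (jlogOf C)))
    (slotDom_congr
      (slotDom_of_records CellB hV hΛc.le hcellB WB stepB EB BkB hEB hκ ρB hρB hρbarB ηB hηB hηbarB hσ (jlogOf C)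
        (jlogOf_le C) hdomB)
      (twoRate_budget_eq (ρbar * Real.exp (-κ₁)) V (Λc * Real.exp (ηbar - κ₁)) (jlogOf C)))
    hSh hΛ hρ0 hρ1 hq hθ hθ1 hCr hx hc hSB hAkp hKkp hτkp hr₁ hskp
    hbkp hrate' hsmall hdd hce hp hP5 F hβ' hL hpos hle1 hrg hub Rw hRj hxK hcK hNsz Gl birth Clean led rem dom hDisc
    hloc hreach hdsz hwAΛ hwBΛ hwA hwB hzero hbirth hhost hsizeA hsizeB h126 hvol hQy hQo hQyc hQoc hnd hinj hRem hr hu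
    hs hs₂

end SocketRecords

section SchemeSocketRecords

open Missing T4Continuum T4Assembly

variable {G : Type*} [GaugeGroup G] [MeasurableSpace G] [HaarData G] {O : Type*}
variable {Dom Cube : ℕ → Type*} [∀ K, DecidableEq (Dom K)] [∀ K, DecidableEq (Cube K)]
  (inc : (K : ℕ) → Dom K → Dom K → Prop) [∀ K, DecidableRel (inc K)] [∀ K, Fintype (Dom K)]
  [∀ K, Std.Refl (inc K)] [∀ K, Std.Symm (inc K)]
  {κ η : Type*} [DecidableEq κ] [DecidableEq η] {ιL Op : Type*} [DecidableEq ιL]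

/-- **PER STRING, END TO END, NE7c SIDE A SOCKET** (= `T4MatchingClosureRecords.stringHybridNE7_closure_records` with
the flattened shell block REPLACED by `hSh : ShellWeightBound l₀ T A B shA shB Wsh` and `hSB` on the hybrid cores) ⇒
`∃ K₁, StringHybridNE7 S os l₀ vol (K₀ + K₁)`, literally the per-string hypothesis of
`T4MatchingClosureHosts.hasContinuumLimit_of_stringClosures` (packaging `T4MatchingClosure.stringHybridNE7_of_shift`).
[folklore] -/
theorem stringHybridNE7_closure_socket_records (S : TorusScheme G O) (os : List O) (K₀ : ℕ) {ι : Type}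
    [DecidableEq ι] {l₀ vol : ℝ} {T : ℕ → Finset ι} {A B shA shB : ℕ → ℝ → ι → ℝ} {Bad : ℕ → ℝ → Finset ι}
    {Cc Rr CcRec RrRec RrRem : ℕ → ℝ → ι → ℝ} {ν u' s₂ c₀ r' s Wsh : ℕ → ℝ}
    {Λ C' ρ θ Cr x c : ℝ} {dd Lb rr : ℕ}
    {C : ℝ} {γA εA γB εB : Type*} [DecidableEq γA] [DecidableEq εA] [DecidableEq γB] [DecidableEq εB]
    {V Λc κ₁ ρbar ηbar : ℝ} (hV : 0 ≤ V) (hΛc : 0 < Λc) (hκ : 0 ≤ κ₁) (hσ : Λc * Real.exp (ηbar - κ₁) < 1)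
    (hC : 1 < C * (-Real.log (Λc * Real.exp (ηbar - κ₁))))
    (hA : ∀ K t, |t| ≤ l₀ → ∀ τ ∈ T K, 0 ≤ A K t τ) (hB : ∀ K t, |t| ≤ l₀ → ∀ τ ∈ T K, 0 ≤ B K t τ)
    -- ─── in the slot of `hDA`: run A's persistence RECORD MODEL (`T4PersistentHistoryCount` §1–§3) ───
    (CellA : ℕ → ℕ → Finset γA) (hcellA : ∀ K a, ((CellA K a).card : ℝ) ≤ V * Λc ^ a)
    (WA stepA : εA → ℕ) (EA BkA : ℕ → ℕ → Finset εA) (hEA : ∀ K j, ∀ e ∈ EA K j, stepA e ∈ Ioc j K)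
    (ρA : εA → ℝ) (hρA : ∀ K j, ∀ b ∈ BkA K j, 0 ≤ ρA b) (hρbarA : ∀ K j, ∑ b ∈ BkA K j, ρA b ≤ ρbar)
    (ηA : εA → ℝ) (hηA : ∀ K j, ∀ e ∈ EA K j, 0 ≤ ηA e)
    (hηbarA : ∀ K j, ∀ n ∈ Ioc j K, ∑ e ∈ EA K j with stepA e = n, ηA e ≤ ηbar)
    (hdomA : ∀ K t, |t| ≤ l₀ → ∃ (n : ℕ) (Φ : SwitchOff (T K) n) (bth : Fin n → ℕ) (cell : Fin n → γA)
        (y : Fin n → εA → Finset εA → ℝ),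
      Bad K t = Φ.bad ∧ (∀ i, bth i < jlogOf C K) ∧ (∀ i, cell i ∈ CellA K (K - bth i)) ∧
      Function.Injective (fun i => (⟨bth i, cell i⟩ : Σ _ : ℕ, γA)) ∧
      (∀ i, ∀ b ∈ BkA K (bth i), ∀ Q ∈ records WA (bth i) K (EA K (bth i)) b, 0 ≤ y i b Q) ∧
      (∀ i, ∀ b ∈ BkA K (bth i), ∀ Q ∈ records WA (bth i) K (EA K (bth i)) b,
        y i b Q ≤ ρA b * Real.exp (-(κ₁ * WA b)) * ∏ e ∈ Q, (Real.exp (-(κ₁ * WA e)) * ηA e)) ∧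
      ∀ i : Fin n, ∀ τ'' ∈ T K, Φ.pend i τ'' = false →
        ∑ τ ∈ T K with (Φ.pend i τ = true ∧ Φ.off i τ = τ''), A K t τ ≤
          (∑ b ∈ BkA K (bth i), ∑ Q ∈ records WA (bth i) K (EA K (bth i)) b, y i b Q) * A K t τ'')
    -- ─── in the slot of `hDB`: run B's persistence RECORD MODEL (`T4PersistentHistoryCount` §1–§3) ───
    (CellB : ℕ → ℕ → Finset γB) (hcellB : ∀ K a, ((CellB K a).card : ℝ) ≤ V * Λc ^ a)
    (WB stepB : εB → ℕ) (EB BkB : ℕ → ℕ → Finset εB) (hEB : ∀ K j, ∀ e ∈ EB K j, stepB e ∈ Ioc j K)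
    (ρB : εB → ℝ) (hρB : ∀ K j, ∀ b ∈ BkB K j, 0 ≤ ρB b) (hρbarB : ∀ K j, ∑ b ∈ BkB K j, ρB b ≤ ρbar)
    (ηB : εB → ℝ) (hηB : ∀ K j, ∀ e ∈ EB K j, 0 ≤ ηB e)
    (hηbarB : ∀ K j, ∀ n ∈ Ioc j K, ∑ e ∈ EB K j with stepB e = n, ηB e ≤ ηbar)
    (hdomB : ∀ K t, |t| ≤ l₀ → ∃ (n : ℕ) (Φ : SwitchOff (T K) n) (bth : Fin n → ℕ) (cell : Fin n → γB)
        (y : Fin n → εB → Finset εB → ℝ),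
      Bad K t = Φ.bad ∧ (∀ i, bth i < jlogOf C K) ∧ (∀ i, cell i ∈ CellB K (K - bth i)) ∧
      Function.Injective (fun i => (⟨bth i, cell i⟩ : Σ _ : ℕ, γB)) ∧
      (∀ i, ∀ b ∈ BkB K (bth i), ∀ Q ∈ records WB (bth i) K (EB K (bth i)) b, 0 ≤ y i b Q) ∧
      (∀ i, ∀ b ∈ BkB K (bth i), ∀ Q ∈ records WB (bth i) K (EB K (bth i)) b,
        y i b Q ≤ ρB b * Real.exp (-(κ₁ * WB b)) * ∏ e ∈ Q, (Real.exp (-(κ₁ * WB e)) * ηB e)) ∧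
      ∀ i : Fin n, ∀ τ'' ∈ T K, Φ.pend i τ'' = false →
        ∑ τ ∈ T K with (Φ.pend i τ = true ∧ Φ.off i τ = τ''), B K t τ ≤
          (∑ b ∈ BkB K (bth i), ∑ Q ∈ records WB (bth i) K (EB K (bth i)) b, y i b Q) * B K t τ'')
    -- ─── in the slot of the flattened shell block: THE GENERAL NE7c SOCKET, (S1)–(S4) ───
    (hSh : ShellWeightBound l₀ T A B shA shB Wsh)
    (hΛ : 1 ≤ Λ) (hρ0 : 0 < ρ) (hρ1 : ρ < 1)
    (hq : ((⌈C * Real.log Λ⌉₊ : ℕ) : ℝ) + 3 ≤ C' * (-Real.log ρ)) (hθ : 0 < θ) (hθ1 : θ < 1) (hCr : 0 ≤ Cr)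
    (hx : 0 ≤ x) (hc : 0 ≤ c)
    (hSB : RemnantSplitBudget l₀ vol T (fun K t τ => A K t τ - shA K t τ) (fun K t τ => B K t τ - shB K t τ) Bad
      Cc Rr CcRec RrRec RrRem ν u' s₂ c₀ r' s)
    -- ─── in the slot of `hsteps`: the producer's binders (uniform / per cutoff / per term) ───
    {Akp Rkp r₁ skp κ₀ Kkp c₁ bkp τkp νkp : ℝ}
    (hAkp : 0 ≤ Akp) (hKkp : 0 ≤ Kkp) (hτkp : 0 ≤ τkp) (hr₁ : 0 ≤ r₁) (hskp : 0 ≤ skp) (hbkp : 0 ≤ bkp)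
    (hrate' : κ₀ + (r₁ + skp) + τkp * c₁ ≤ Rkp) (hsmall : Akp * Real.exp (bkp + τkp * c₁) * Kkp * νkp ≤ τkp)
    (hdd : 1 ≤ dd) {ce cs p₀ : ℝ} (hce : 0 < ce) (hp : 0 < p₀) (hP5 : ce ≤ cs * p₀)
    (F : ℕ → Flow) {β' : ℝ} (hβ' : 0 ≤ β') (hL : 1 ≤ Lb)
    (hpos : ∀ K j, j ≤ K → 0 < (F K).g j) (hle1 : ∀ K j, j ≤ K → (F K).g j ≤ 1) (hrg : ∀ K, (F K).SatisfiesRG K)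
    (hub : ∀ K j, j < K → (F K).β (j + 1) ((F K).g j) ≤ β') (Rw : ℕ → ℕ → ℕ)
    (hRj : ∀ K j, j ≤ K → B14.IsRj Lb rr ((F K).g j) (Rw K j))
    (hxK : ∀ K, Real.log (((F K).g K) ^ 2)⁻¹ ≤ x) (hcK : ∀ K, ((F K).g K) ^ 2 * β' ≤ c)
    {Nsz : ℕ} (hNsz : 64 ≤ Nsz)
    {Cat Disc : (K : ℕ) → ℝ → ι → ℕ → Finset (Dom K)}
    {cubes out reach : (K : ℕ) → ℝ → ι → ℕ → Dom K → Finset (Cube K)} {dsz : (K : ℕ) → ℝ → ι → ℕ → Dom K → ℝ}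
    {wA wB : (K : ℕ) → ℝ → ι → ℕ → Dom K → ℂ}
    (Gl : (K : ℕ) → ℝ → ι → ℕ → Dom K → GeoLedger dd κ η) (birth : (K : ℕ) → ℝ → ι → ℕ → Dom K → ℕ)
    (Clean : (K : ℕ) → ℝ → ι → ℕ → Dom K → ℕ → ℕ → Prop) {Qy Qo : (K : ℕ) → ℝ → ι → ℕ → Finset (Cube K)}
    (led : ℕ → ℝ → ι → Ledger ιL Op) (rem : ℕ → ℝ → ι → ℕ → Finset ιL)
    (dom : (K : ℕ) → ℝ → ι → ιL → Finset (Cube K))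
    (hDisc : ∀ K t, |t| ≤ l₀ → ∀ τ ∈ T K \ Bad K t, ∀ j, Disc K t τ j ⊆ Cat K t τ j)
    (hloc : ∀ K t, |t| ≤ l₀ → ∀ τ ∈ T K \ Bad K t,
      ∀ j Z, ∀ Z' ∈ Cat K t τ j, inc K Z' Z → ∃ q ∈ reach K t τ j Z, q ∈ out K t τ j Z')
    (hreach : ∀ K t, |t| ≤ l₀ → ∀ τ ∈ T K \ Bad K t,
      ∀ j Z, ((reach K t τ j Z).card : ℝ) ≤ νkp * (out K t τ j Z).card)
    (hdsz : ∀ K t, |t| ≤ l₀ → ∀ τ ∈ T K \ Bad K t, ∀ j Z, 0 ≤ dsz K t τ j Z)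
    (hwAΛ : ∀ K t, |t| ≤ l₀ → ∀ τ ∈ T K \ Bad K t, ∀ j Z, Z ∉ Cat K t τ j → wA K t τ j Z = 0)
    (hwBΛ : ∀ K t, |t| ≤ l₀ → ∀ τ ∈ T K \ Bad K t, ∀ j Z, Z ∉ Cat K t τ j → wB K t τ j Z = 0)
    (hwA : ∀ K t, |t| ≤ l₀ → ∀ τ ∈ T K \ Bad K t,
      ∀ j Z, ‖wA K t τ j Z‖ ≤ Akp * Real.exp (-(Rkp * dsz K t τ j Z)))
    (hwB : ∀ K t, |t| ≤ l₀ → ∀ τ ∈ T K \ Bad K t,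
      ∀ j Z, ‖wB K t τ j Z‖ ≤ Akp * Real.exp (-(Rkp * dsz K t τ j Z)))
    (hzero : ∀ K t, |t| ≤ l₀ → ∀ τ ∈ T K \ Bad K t,
      ∀ j, ∀ Z ∈ Cat K t τ j, Z ∉ Disc K t τ j → wA K t τ j Z = wB K t τ j Z)
    (hbirth : ∀ K t, |t| ≤ l₀ → ∀ τ ∈ T K \ Bad K t, ∀ j ∈ Icc (jlogOf C K) K, ∀ Z ∈ Disc K t τ j,
      BankYoung₂ (Gl K t τ j Z) ce cs p₀ C' K →
        ‖wA K t τ j Z - wB K t τ j Z‖ ≤ Cr * θ ^ birth K t τ j Z * (Akp * Real.exp (-(Rkp * dsz K t τ j Z))))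
    (hhost : ∀ K t, |t| ≤ l₀ → ∀ τ ∈ T K \ Bad K t, ∀ j ∈ Icc (jlogOf C K) K, ∀ Z ∈ Disc K t τ j,
      BankYoung₂ (Gl K t τ j Z) ce cs p₀ C' K →
        Hosts (Gl K t τ j Z) (birth K t τ j Z) j Nsz (Rw K) (Clean K t τ j Z))
    (hsizeA : ∀ K t, |t| ≤ l₀ → ∀ τ ∈ T K \ Bad K t, ∀ j ∈ Icc (jlogOf C K) K, ∀ Z ∈ Disc K t τ j,
      ¬BankYoung₂ (Gl K t τ j Z) ce cs p₀ C' K →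
        ‖wA K t τ j Z‖ ≤ ρ ^ ageCut C' K * (Akp * Real.exp (-(Rkp * dsz K t τ j Z))))
    (hsizeB : ∀ K t, |t| ≤ l₀ → ∀ τ ∈ T K \ Bad K t, ∀ j ∈ Icc (jlogOf C K) K, ∀ Z ∈ Disc K t τ j,
      ¬BankYoung₂ (Gl K t τ j Z) ce cs p₀ C' K →
        ‖wB K t τ j Z‖ ≤ ρ ^ ageCut C' K * (Akp * Real.exp (-(Rkp * dsz K t τ j Z))))
    (h126 : ∀ K t, |t| ≤ l₀ → ∀ τ ∈ T K \ Bad K t, ∀ j, Ineq126 (Cat K t τ j) (out K t τ j) (dsz K t τ j) κ₀ Kkp)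
    (hvol : ∀ K t, |t| ≤ l₀ → ∀ τ ∈ T K \ Bad K t, ∀ j, VolBound (Cat K t τ j) (out K t τ j) (dsz K t τ j) c₁)
    (hQy : ∀ K t, |t| ≤ l₀ → ∀ τ ∈ T K \ Bad K t, ∀ j ∈ Icc (jlogOf C K) K, ∀ Z ∈ Disc K t τ j,
      BankYoung₂ (Gl K t τ j Z) ce cs p₀ C' K → ∃ q ∈ Qy K t τ j, q ∈ out K t τ j Z)
    (hQo : ∀ K t, |t| ≤ l₀ → ∀ τ ∈ T K \ Bad K t, ∀ j ∈ Icc (jlogOf C K) K, ∀ Z ∈ Disc K t τ j,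
      ¬BankYoung₂ (Gl K t τ j Z) ce cs p₀ C' K → ∃ q ∈ Qo K t τ j, q ∈ out K t τ j Z)
    (hQyc : ∀ K t, |t| ≤ l₀ → ∀ τ ∈ T K \ Bad K t,
      ∀ j ∈ Icc (jlogOf C K) K, ((Qy K t τ j).card : ℝ) ≤ vol * Λ ^ (K - j))
    (hQoc : ∀ K t, |t| ≤ l₀ → ∀ τ ∈ T K \ Bad K t,
      ∀ j ∈ Icc (jlogOf C K) K, ((Qo K t τ j).card : ℝ) ≤ vol * Λ ^ (K - j))
    (hnd : ∀ K t, |t| ≤ l₀ → ∀ τ ∈ T K \ Bad K t, (led K t τ).leaves.Nodup)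
    (hinj : ∀ K t, |t| ≤ l₀ → ∀ τ ∈ T K \ Bad K t, ∀ j, Set.InjOn (dom K t τ) ↑(rem K t τ j))
    (hRem : ∀ K t, |t| ≤ l₀ → ∀ τ ∈ T K \ Bad K t,
      RrRem K t τ ≤ ∑ j ∈ Icc (jlogOf C K) K, (led K t τ).leafSum fun i => if i ∈ rem K t τ j then
        ‖locR (inc K) (Cat K t τ j) (cubes K t τ j) (wA K t τ j) (dom K t τ i) -
          locR (inc K) (Cat K t τ j) (cubes K t τ j) (wB K t τ j) (dom K t τ i)‖ else 0)
    -- ─── the consumer's tail ───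
    (hr : Summable r') (hu : Summable u') (hs : Summable s) (hs₂ : Summable s₂)
    (hZA : ∀ K t, |t| ≤ l₀ → T4GenFunBounds.schemeZ S os (K₀ + K) t = ∑ τ ∈ T K, A K t τ)
    (hZB : ∀ K t, |t| ≤ l₀ → T4GenFunBounds.schemeZ S os (K₀ + K + 1) t = ∑ τ ∈ T K, B K t τ) :
    ∃ K₁, StringHybridNE7 S os l₀ vol (K₀ + K₁) := by
  obtain ⟨K₁, h⟩ := hybridNE7_closure_socket_records inc
    hV hΛc hκ hσ hC hA hB CellA hcellA WA stepA EA BkA hEA ρA hρA hρbarA ηA hηA hηbarA hdomA CellB hcellB WB stepB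
    EB BkB hEB ρB hρB hρbarB ηB hηB hηbarB hdomB hSh hΛ hρ0 hρ1 hq hθ hθ1 hCr hx hc hSB hAkp hKkp hτkp hr₁ hskp
    hbkp hrate' hsmall hdd hce hp hP5 F hβ' hL hpos hle1 hrg hub Rw hRj hxK hcK hNsz Gl birth Clean led rem dom
    hDisc hloc hreach hdsz hwAΛ hwBΛ hwA hwB hzero hbirth hhost hsizeA hsizeB h126 hvol hQy hQo hQyc hQoc hnd hinj
    hRem hr hu hs hs₂
  exact ⟨K₁, stringHybridNE7_of_shift S os K₀ K₁ h hZA hZB⟩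

end SchemeSocketRecords

/-! ## §4 The landed flattened chain is the instance `hSh := T4NestedShells.shellWeightBound_of_flattened …`;
non-vacuity of the general tail closure -/

section Flattened

variable {ι : Type*} [DecidableEq ι] {l₀ vol : ℝ} {T : ℕ → Finset ι} {A B Acore Bcore : ℕ → ℝ → ι → ℝ}
  {Bad : ℕ → ℝ → Finset ι} {Cc Rr CcRec RrRec RrRem : ℕ → ℝ → ι → ℝ} {ν u s₂ c₀ r s L : ℕ → ℝ}

/-- TRANSPORT: a `ReindexedBudget` on cores `Acore`, `Bcore` IS one on the hybrid cores `X − (X − Xcore)` of the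
flattened presentation `shX := X − Xcore` (`sub_sub_cancel`, cf. `T4NestedShells.core_eq`; the budget-level form of
`T4NestedShells.hcore_of_cores`). [folklore] -/
theorem reindexedBudget_of_cores (h : ReindexedBudget l₀ vol T Acore Bcore Bad Cc Rr CcRec RrRec ν u s₂ c₀ r s) :
    ReindexedBudget l₀ vol T (fun K t τ => A K t τ - (A K t τ - Acore K t τ))
      (fun K t τ => B K t τ - (B K t τ - Bcore K t τ)) Bad Cc Rr CcRec RrRec ν u s₂ c₀ r s where
  nonneg K t ht τ hτ := by simpa only [sub_sub_cancel] using h.nonneg K t ht τ hτ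
  lower K t ht τ hτ := by simpa only [sub_sub_cancel] using h.lower K t ht τ hτ
  upper K t ht τ hτ := by simpa only [sub_sub_cancel] using h.upper K t ht τ hτ
  uv_const := h.uv_const
  uv_radius := h.uv_radius
  recent_remainder := h.recent_remainder
  recent_deviation := h.recent_deviation

/-- TRANSPORT, split-budget form (feeds `hybridNE7_closure_socket_fed_steps` / `…_hosts` / `…_records` from a
`RemnantSplitBudget` on the flattened cores). [folklore] -/
theorem remnantSplitBudget_of_cores
    (h : RemnantSplitBudget l₀ vol T Acore Bcore Bad Cc Rr CcRec RrRec RrRem ν u s₂ c₀ r s) :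
    RemnantSplitBudget l₀ vol T (fun K t τ => A K t τ - (A K t τ - Acore K t τ))
      (fun K t τ => B K t τ - (B K t τ - Bcore K t τ)) Bad Cc Rr CcRec RrRec RrRem ν u s₂ c₀ r s where
  nonneg K t ht τ hτ := by simpa only [sub_sub_cancel] using h.nonneg K t ht τ hτ
  lower K t ht τ hτ := by simpa only [sub_sub_cancel] using h.lower K t ht τ hτ
  upper K t ht τ hτ := by simpa only [sub_sub_cancel] using h.upper K t ht τ hτ
  uv_const := h.uv_const
  uv_radius := h.uv_radius
  recent_remainder := h.recent_remainder
  recent_deviation := h.recent_deviation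

-- THE LANDED FLATTENED CHAIN IS AN INSTANCE OF THE SOCKET: the conclusion of `T4MatchingClosure.hybridNE7_closure_tail`,
-- letter for letter, from `hybridNE7_closure_socket` at `hSh := T4NestedShells.shellWeightBound_of_flattened …` and the
-- transported budget `reindexedBudget_of_cores hTB` (kernel-checked; the higher levels specialise the same way through
-- `remnantSplitBudget_of_cores`).
example {r₀ V C : ℝ} (h0 : 0 < r₀) (h1 : r₀ < 1) (hV : 0 ≤ V) (hC : 1 < C * (-Real.log r₀))
    (hA : ∀ K t, |t| ≤ l₀ → ∀ τ ∈ T K, 0 ≤ A K t τ) (hB : ∀ K t, |t| ≤ l₀ → ∀ τ ∈ T K, 0 ≤ B K t τ)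
    (hDA : SlotDom l₀ T A Bad fun K => V * r₀ ^ (K - jlogOf C K))
    (hDB : SlotDom l₀ T B Bad fun K => V * r₀ ^ (K - jlogOf C K))
    (hL0 : ∀ K, 0 ≤ L K) (hLs : Summable L)
    (hA0 : ∀ K t, |t| ≤ l₀ → ∀ τ ∈ T K, 0 ≤ Acore K t τ)
    (hAlo : ∀ K t, |t| ≤ l₀ → ∀ τ ∈ T K, Acore K t τ ≤ A K t τ)
    (hAhi : ∀ K t, |t| ≤ l₀ → ∀ τ ∈ T K, A K t τ ≤ Real.exp (L K) * Acore K t τ)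
    (hB0 : ∀ K t, |t| ≤ l₀ → ∀ τ ∈ T K, 0 ≤ Bcore K t τ)
    (hBlo : ∀ K t, |t| ≤ l₀ → ∀ τ ∈ T K, Bcore K t τ ≤ B K t τ)
    (hBhi : ∀ K t, |t| ≤ l₀ → ∀ τ ∈ T K, B K t τ ≤ Real.exp (L K) * Bcore K t τ)
    (hTB : ReindexedBudget l₀ vol T Acore Bcore Bad Cc Rr CcRec RrRec ν u s₂ c₀ r s)
    (hr : Summable r) (hu : Summable u) (hs : Summable s) (hs₂ : Summable s₂) :
    ∃ K₀, HybridNE7 l₀ vol (fun K => T (K₀ + K)) (fun K => A (K₀ + K)) (fun K => B (K₀ + K)) (fun K => Bad (K₀ + K))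
      (fun K => 1 - Real.exp (-(V * r₀ ^ (K₀ + K - jlogOf C (K₀ + K)))))
      (fun K t τ => A (K₀ + K) t τ - Acore (K₀ + K) t τ) (fun K t τ => B (K₀ + K) t τ - Bcore (K₀ + K) t τ)
      (fun K => 1 - Real.exp (-L (K₀ + K)))
      (fun K => (r (K₀ + K) + u (K₀ + K)) + (s (K₀ + K) + s₂ (K₀ + K))) :=
  hybridNE7_closure_socket h0 h1 hV hC hA hB hDA hDB
    (T4NestedShells.shellWeightBound_of_flattened hL0 hLs hA0 hAlo hAhi hB0 hBlo hBhi) (reindexedBudget_of_cores hTB)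
    hr hu hs hs₂

end Flattened

section Sanity

/-- SANITY: the trivial `ReindexedBudget` of `T4MatchingClosure.reindexedBudget_trivial` written ON THE HYBRID CORES
`1 − 0` (the shape `hybridNE7_closure'_tail` asks when `A = B = 1`, `shA = shB = 0`). [folklore] -/
theorem reindexedBudget_trivial_cores (l₀ vol : ℝ) :
    ReindexedBudget l₀ vol (fun _ => ({()} : Finset Unit)) (fun _ _ _ => (1 : ℝ) - 0) (fun _ _ _ => (1 : ℝ) - 0)
      (fun _ _ => ∅) (fun _ _ _ => 0) (fun _ _ _ => 0) (fun _ _ _ => 0) (fun _ _ _ => 0) (fun _ => 0) (fun _ => 0)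
      (fun _ => 0) (fun _ => 0) (fun _ => 0) (fun _ => 0) where
  nonneg _ _ _ _ _ := by simp
  lower _ _ _ _ _ := by simp
  upper _ _ _ _ _ := by simp
  uv_const _ _ _ _ _ := by simp
  uv_radius _ _ _ _ _ := by simp
  recent_remainder _ _ _ _ _ := by simp
  recent_deviation _ _ _ _ _ := by simp

-- SANITY (non-vacuity of the GENERAL tail closure's binder list, honest scope): on the trivial datum of
-- `T4MatchingAssembly.hybridNE7_trivial` — its OWN `weight` and `shell` fields as the two socket structures — with the
-- trivial budget on the cores and zero rates, `hybridNE7_closure'_tail` fires and (all families being constant in `K`)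
-- RETURNS the trivial datum with remainder rate `(0 + 0) + (0 + 0)` (kernel-checked).  Shows only that the hypotheses
-- are jointly satisfiable; the content of node U5 is in the producers.
example (l₀ vol : ℝ) :
    HybridNE7 l₀ vol (fun _ => ({()} : Finset Unit)) (fun _ _ _ => 1) (fun _ _ _ => 1) (fun _ _ => ∅) (fun _ => 0)
      (fun _ _ _ => 0) (fun _ _ _ => 0) (fun _ => 0) (fun _ => ((0 : ℝ) + 0) + (0 + 0)) := by
  obtain ⟨_, h⟩ := hybridNE7_closure'_tail (hybridNE7_trivial l₀ vol).weight (hybridNE7_trivial l₀ vol).shell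
    (reindexedBudget_trivial_cores l₀ vol) summable_zero summable_zero summable_zero summable_zero
  exact h

end Sanity

end Literature.MathematicalPhysics.QuantumFieldTheory.Balaban1983to89.T4MatchingClosureSocket
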